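import Literature.Analysis.FluidPDE.GloballyDissipativeEulerProofs
import Literature.Analysis.FluidPDE.OnsagerBDSVParameters
import Literature.Analysis.FunctionSpaces.SpaceTimeLipschitz
import Literature.Analysis.FunctionSpaces.TorusDerivBounds
import HarnessLib

/-!
# De Lellis–Kwon 2022, Thm. 1.1 from the output of the iteration with its printed estimates
# (§2.1–§2.3: parameters, (2.4), (2.7), (2.8), (2.10), `p_{q+1} = p_q`, and the interpolation
# bookkeeping of §2.2)

Proofs file on the discharge path of the named fact `Torus.DeLellisKwon2022_thm11`
(`GloballyDissipativeEuler`; C. De Lellis, H. Kwon, Anal. PDE 15 (2022) = arXiv:2006.06482,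
Thm. 1.1). The printed proof (§2.3 with §2.2) runs the inductive Prop. 2.3 from the starting
tuple of §2.3 and obtains a sequence of dissipative Euler–Reynolds flows
`(v_q, p_q, R_q, κ_q, φ_q)` (Def. 2.1) with a common energy loss `E`, the frequencies
`λ_q = ⌈a^{b^q}⌉` and amplitudes `δ_q = λ_q^{-2α}` of §2.1, satisfying the inductive estimates
(2.4)–(2.8) and the increment bound (2.10)
`‖v_{q+1} - v_q‖₀ + λ_{q+1}⁻¹‖v_{q+1} - v_q‖₁ ≤ M δ_{q+1}^{1/2}`, with no pressure correction
(§4.2: "`p_{q+1} = p_q`"). §2.2 then shows: `{v_q}` is Cauchy in `C⁰_t C^β_x` for `β < α` by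
interpolating (2.10) (`‖·‖_{C^β} ≲ ‖·‖₀^{1-β}‖·‖₁^β`, `λ_{q+1}^β δ_{q+1}^{1/2} = λ_{q+1}^{β-α}`
summable), the time regularity follows from `‖∂ₜv_q‖₀ ≤ ‖v_q‖₀‖Dv_q‖₀ + ‖Dp_q‖₀ + ‖DR_q‖₀` and
"an analogous interpolation argument", the errors `(R_q, κ_q, φ_q) → 0` uniformly by (2.7)–(2.8)
and `κ_q = ½ tr R_q`, so the limit is a globally dissipative Euler flow of class `C^β` with
local energy balance `E'` (normalised: `E'/2`), whence (Onsager) when `E(T) < E(0)`.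

This file proves exactly this passage, on the unit torus `𝕋³` (frequencies
`λ_q = 2π⌈a^{b^q}⌉ = BDSV.freq a b q`, `δ_q = BDSV.amp α a b q`):

* `DLK.IsIterationSequence M α a b T E v p R κ φ` — the printed output of the iteration
  restricted to `[0,T]`: each stage is a dissipative Euler–Reynolds flow on `[0,T] × 𝕋³` with
  energy loss `E` (`Torus.IsDissipativeEulerReynoldsOn`), the order `≤ 1` parts of (2.4), (2.7)
  and the order-`0` part of (2.8) (exactly what §2.2 uses), the increment bound (2.10) split as
  `‖v_{q+1}-v_q‖₀ ≤ Mδ_{q+1}^{1/2}`, `[v_{q+1}-v_q]₁ ≤ Mλ_{q+1}δ_{q+1}^{1/2}`, and `p_{q+1} = p_q`;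
* `DLK.norm_timeDerivWithin_velocity_le` — the bound `‖∂ₜ v_q‖₀ ≤ 3(M+2) λ_q δ_q^{1/2}` from the
  momentum equation (§2.2: "Estimating `‖∂ₜv_q‖₀ ≤ ‖v_q‖₀‖Dv_q‖₀ + ‖Dp_q‖₀ + ‖DR_q‖₀`");
* `DLK.deLellisKwon2022_thm11_witness_of_iterationSequence` — **§2.2–2.3 assembled**: for
  `0 ≤ β < α ≤ 1/2`, `a > 1`, `b > 1`, `M ≥ 0`, `T > 0`, an iteration sequence with `E' ≤ 0` on
  `[0,T]` and `E(T) < E(0)` yields a globally dissipative Euler flow `u ∈ C^β([0,T] × 𝕋³)` with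
  `½∫|u(T)|² < ½∫|u(0)|²` (via `Torus.exists_unifTo_holderOnSpaceTime` and
  `Torus.deLellisKwon2022_thm11_witness_of_iteration`);
* `DLK.deLellisKwon2022_thm11_of_iterationSequences` — hence `Torus.DeLellisKwon2022_thm11`
  follows as soon as such sequences exist for every `β < 1/7` and `T > 0`, which is the content
  of DLK Prop. 2.3 run from the starting tuple of §2.3 (`DLK.isDissipativeEulerReynoldsOn_start`,
  `GloballyDissipativeEulerStart`) — the convex-integration construction of §§3–11, not
  formalised here.

## References

* C. De Lellis, H. Kwon, *On nonuniqueness of Hölder continuous globally dissipative Euler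
  flows*, Anal. PDE 15 (2022) 2003–2059 = arXiv:2006.06482: §2.1 (parameters, (2.4)–(2.10)),
  Prop. 2.3, §2.2 (proof of Thm. 1.2: convergence, interpolation, time regularity), §2.3 (proof
  of Thm. 1.1), §4.2 (`p_{q+1} = p_q`). [DelellisKwon2022]
* T. Buckmaster, C. De Lellis, L. Székelyhidi Jr., V. Vicol, CPAM 72 (2019) = arXiv:1701.08678,
  §2.1–2.2 (the same parameters and bookkeeping; `BDSV.freq`, `BDSV.amp`). [BuckmasterEtAl2018]
-/

noncomputable section

open MeasureTheory Set Filter Function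
open scoped ENNReal NNReal InnerProductSpace RealInnerProductSpace ContDiff Topology

namespace Literature.Analysis.FluidPDE

namespace DLK

open FunctionSpaces FunctionSpaces.Torus BDSV

/-- The flat three-torus `𝕋³ = (ℝ/ℤ)³`, local notation. -/
local notation "𝕋³" => UnitAddTorus (Fin 3)

/-- Euclidean `ℝ³`, local notation. -/
local notation "ℝ³" => EuclideanSpace ℝ (Fin 3)

/-! ## The output of the iteration (§2.1, restricted to `[0,T]`) -/

/-- **The sequence produced by the De Lellis–Kwon iteration** (DLK 2022, §2.1 and Prop. 2.3 run
from the starting tuple of §2.3, with `p_{q+1} = p_q` from §4.2), read on the window `[0,T]`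
(the stages live on the larger `[0,T] + τ_{q-1}`): relative to the geometric constant `M`, the
exponent `α`, the parameters `a, b` (`λ_q = 2π⌈a^{b^q}⌉ = BDSV.freq a b q`,
`δ_q = λ_q^{-2α} = BDSV.amp α a b q`, `γ = (b-1)²`), the window `T` and the energy loss `E`,
the tuples `(v_q, p_q, R_q, κ_q, φ_q)` satisfy: (2.1) each is a dissipative Euler–Reynolds flow on
`[0,T] × 𝕋³` with energy loss `E`; (2.4) `‖v_q‖₀ ≤ 1 - δ_q^{1/2}`, `[v_q]₁ ≤ Mλ_qδ_q^{1/2}`,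
`[p_q]₁ ≤ λ_qδ_q`; (2.7) `‖R_q‖₀ ≤ λ_q^{-3γ}δ_{q+1}`, `[R_q]₁ ≤ λ_q^{1-3γ}δ_{q+1}`;
(2.8) `‖φ_q‖₀ ≤ λ_q^{-3γ}δ_{q+1}^{3/2}`; (2.10) `‖v_{q+1} - v_q‖₀ ≤ Mδ_{q+1}^{1/2}`,
`[v_{q+1} - v_q]₁ ≤ Mλ_{q+1}δ_{q+1}^{1/2}`; and §4.2 `p_{q+1} = p_q`. Here `‖·‖₀`, `[·]₁` are sup
norms over `[0,T] × 𝕋³` of the field and of its first spatial partial derivatives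
(`Torus.partialDeriv`; for the stress, of the column-tensor field). Only the parts of
(2.4)–(2.8) of order `≤ 1` that the limit argument of §2.2 uses are recorded.
[cite: DelellisKwon2022, §2.1 (2.4), (2.7), (2.8), (2.10); §4.2] -/
structure IsIterationSequence (M α a b T : ℝ) (E : ℝ → ℝ)
    (v : ℕ → ℝ → 𝕋³ → ℝ³) (p : ℕ → ℝ → 𝕋³ → ℝ) (R : ℕ → ℝ → 𝕋³ → Fin 3 → ℝ³)
    (κ : ℕ → ℝ → 𝕋³ → ℝ) (φ : ℕ → ℝ → 𝕋³ → ℝ³) : Prop where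
  /-- (2.1): every stage is a dissipative Euler–Reynolds flow on `[0,T] × 𝕋³` with loss `E`. -/
  flow : ∀ q, Torus.IsDissipativeEulerReynoldsOn (Icc 0 T) (v q) (p q) (R q) (κ q) (φ q) E
  /-- (2.4): `‖v_q‖₀ ≤ 1 - δ_q^{1/2}`. -/
  velocity_sup : ∀ q, ∀ t ∈ Icc 0 T, ∀ x, ‖v q t x‖ ≤ 1 - Real.sqrt (amp α a b q)
  /-- (2.4), `N = 1`: `[v_q]₁ ≤ M λ_q δ_q^{1/2}`. -/
  velocity_deriv : ∀ q (i : Fin 3), ∀ t ∈ Icc 0 T, ∀ x,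
    ‖Torus.partialDeriv i (v q t) x‖ ≤ M * freq a b q * Real.sqrt (amp α a b q)
  /-- (2.4), `N = 1`: `[p_q]₁ ≤ λ_q δ_q`. -/
  pressure_deriv : ∀ q (i : Fin 3), ∀ t ∈ Icc 0 T, ∀ x,
    ‖Torus.partialDeriv i (p q t) x‖ ≤ freq a b q * amp α a b q
  /-- (2.7), `N = 0`: `‖R_q‖₀ ≤ λ_q^{-3γ} δ_{q+1}`, `γ = (b-1)²`. -/
  stress_sup : ∀ q, ∀ t ∈ Icc 0 T, ∀ x,
    ‖R q t x‖ ≤ freq a b q ^ (-(3 * (b - 1) ^ 2)) * amp α a b (q + 1)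
  /-- (2.7), `N = 1`: `[R_q]₁ ≤ λ_q^{1-3γ} δ_{q+1}`. -/
  stress_deriv : ∀ q (i : Fin 3), ∀ t ∈ Icc 0 T, ∀ x,
    ‖Torus.partialDeriv i (R q t) x‖ ≤ freq a b q ^ (1 - 3 * (b - 1) ^ 2) * amp α a b (q + 1)
  /-- (2.8), `N = 0`: `‖φ_q‖₀ ≤ λ_q^{-3γ} δ_{q+1}^{3/2}`. -/
  current_sup : ∀ q, ∀ t ∈ Icc 0 T, ∀ x,
    ‖φ q t x‖ ≤ freq a b q ^ (-(3 * (b - 1) ^ 2)) * amp α a b (q + 1) ^ (3 / 2 : ℝ)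
  /-- (2.10): `‖v_{q+1} - v_q‖₀ ≤ M δ_{q+1}^{1/2}`. -/
  increment_sup : ∀ q, ∀ t ∈ Icc 0 T, ∀ x,
    ‖v (q + 1) t x - v q t x‖ ≤ M * Real.sqrt (amp α a b (q + 1))
  /-- (2.10): `[v_{q+1} - v_q]₁ ≤ M λ_{q+1} δ_{q+1}^{1/2}`. -/
  increment_deriv : ∀ q (i : Fin 3), ∀ t ∈ Icc 0 T, ∀ x,
    ‖Torus.partialDeriv i (fun y => v (q + 1) t y - v q t y) x‖ ≤
      M * freq a b (q + 1) * Real.sqrt (amp α a b (q + 1))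
  /-- §4.2: no pressure correction, `p_{q+1} = p_q`. -/
  pressure_succ : ∀ q, ∀ t ∈ Icc 0 T, ∀ x, p (q + 1) t x = p q t x

/-! ## Parameter bookkeeping -/

section Parameters

variable {a b α : ℝ}

/-- `δ_{q+1} ≤ δ_q` (`α ≥ 0`). [folklore] -/
theorem amp_succ_le (ha : 1 ≤ a) (hb : 1 ≤ b) (hα : 0 ≤ α) (q : ℕ) :
    amp α a b (q + 1) ≤ amp α a b q := by
  unfold amp
  exact Real.rpow_le_rpow_of_nonpos (freq_pos ha q) (freq_le_freq_succ ha hb q) (by nlinarith)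

/-- `δ_q ≤ δ_q^{1/2}` (as `0 ≤ δ_q ≤ 1`). [folklore] -/
theorem amp_le_sqrt_amp (ha : 1 ≤ a) (hα : 0 ≤ α) (q : ℕ) :
    amp α a b q ≤ Real.sqrt (amp α a b q) := by
  have h0 := (amp_pos (β := α) (b := b) ha q).le
  have h1 := amp_le_one (β := α) (b := b) ha hα q
  exact (Real.le_sqrt h0 h0).2 (by nlinarith)

/-- `δ_q^{1/2} ≤ 1`. [folklore] -/
theorem sqrt_amp_le_one (ha : 1 ≤ a) (hα : 0 ≤ α) (q : ℕ) : Real.sqrt (amp α a b q) ≤ 1 := by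
  rw [sqrt_amp ha]
  exact freq_rpow_neg_le_one ha hα q

/-- `λ_q δ_q^{1/2} = λ_q^{1-α}`. [folklore] -/
theorem freq_mul_sqrt_amp (ha : 1 ≤ a) (q : ℕ) :
    freq a b q * Real.sqrt (amp α a b q) = freq a b q ^ (1 - α) := by
  rw [sqrt_amp ha, sub_eq_add_neg, Real.rpow_add (freq_pos ha q), Real.rpow_one]

/-- `λ_q δ_q^{1/2} ≤ λ_{q+1} δ_{q+1}^{1/2}` for `α ≤ 1` ("`δ_q^{1/2}λ_q` is a monotone increasing
sequence", DLK §2.1). [cite: DelellisKwon2022, §2.1] -/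
theorem freq_mul_sqrt_amp_le_succ (ha : 1 ≤ a) (hb : 1 ≤ b) (hα : α ≤ 1) (q : ℕ) :
    freq a b q * Real.sqrt (amp α a b q) ≤
      freq a b (q + 1) * Real.sqrt (amp α a b (q + 1)) := by
  rw [freq_mul_sqrt_amp ha, freq_mul_sqrt_amp ha]
  exact Real.rpow_le_rpow (freq_pos ha q).le (freq_le_freq_succ ha hb q) (by linarith)

/-- `δ_{q+1} → 0` (`a, b > 1`, `α > 0`). [folklore] -/
theorem tendsto_amp_succ (ha : 1 < a) (hb : 1 < b) (hα : 0 < α) :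
    Tendsto (fun q : ℕ => amp α a b (q + 1)) atTop (𝓝 0) := by
  have h := (summable_freq_succ_rpow_neg ha hb (by linarith : 0 < 2 * α)).tendsto_atTop_zero
  refine h.congr fun q => ?_
  rw [amp]
  congr 1
  ring

/-- A sequence of fields dominated by a null sequence of constants vanishes uniformly, in the
`ε`–`N` form of the tree's limit lemmas. [folklore] -/
theorem unifSmall_of_le_of_tendsto {Y : Type*} [NormedAddCommGroup Y] {S : Set ℝ}
    {F : ℕ → ℝ → 𝕋³ → Y} {c : ℕ → ℝ} (hF : ∀ q, ∀ t ∈ S, ∀ x, ‖F q t x‖ ≤ c q)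
    (hc : Tendsto c atTop (𝓝 0)) :
    ∀ ε > (0 : ℝ), ∃ N : ℕ, ∀ q ≥ N, ∀ t ∈ S, ∀ x, ‖F q t x‖ ≤ ε := fun ε hε => by
  obtain ⟨N, hN⟩ := (Metric.tendsto_atTop.1 hc) ε hε
  refine ⟨N, fun q hq t ht x => (hF q t ht x).trans ?_⟩
  have := hN q hq
  rw [Real.dist_0_eq_abs] at this
  exact (le_abs_self _).trans this.le

end Parameters

/-! ## The time derivative of the velocity from the momentum equation (§2.2) -/

section TimeDerivative

variable {d : Type*} [Fintype d] [DecidableEq d]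

/-- `‖(u·∇)w (x)‖ ≤ |d| ‖u(x)‖ [w]₁`: the convective derivative in coordinates
(`Dw(x)[u] = ∑ᵢ uᵢ ∂ᵢw`). [folklore] -/
theorem norm_convect_le {Y : Type*} [NormedAddCommGroup Y] [NormedSpace ℝ Y]
    {u : UnitAddTorus d → EuclideanSpace ℝ d} {w : UnitAddTorus d → Y} (hw : IsContDiff 1 w)
    {A B : ℝ} (x : UnitAddTorus d) (hu : ‖u x‖ ≤ A) (hB : ∀ i, ‖Torus.partialDeriv i w x‖ ≤ B) :
    ‖Torus.convect u w x‖ ≤ Fintype.card d * (A * B) := by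
  have hA : 0 ≤ A := (norm_nonneg _).trans hu
  unfold Torus.convect
  rw [fderiv_apply_eq_sum_partialDeriv hw]
  calc ‖∑ i, u x i • Torus.partialDeriv i w x‖ ≤ ∑ i, ‖u x i • Torus.partialDeriv i w x‖ :=
        norm_sum_le _ _
    _ ≤ ∑ _i : d, A * B := Finset.sum_le_sum fun i _ => by
        rw [norm_smul]
        exact mul_le_mul ((PiLp.norm_apply_le (u x) i).trans hu) (hB i) (norm_nonneg _) hA
    _ = Fintype.card d * (A * B) := by
        rw [Finset.sum_const, Finset.card_univ, nsmul_eq_mul]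

/-- `‖∇θ(x)‖ ≤ |d| [θ]₁` (gradient in coordinates). [folklore] -/
theorem norm_gradient_le {θ : UnitAddTorus d → ℝ} (hθ : IsContDiff 1 θ) {C : ℝ} (x : UnitAddTorus d)
    (hC : ∀ i, ‖Torus.partialDeriv i θ x‖ ≤ C) :
    ‖Torus.gradient θ x‖ ≤ Fintype.card d * C := by
  rw [gradient_eq_sum_partialDeriv hθ]
  calc ‖∑ i, Torus.partialDeriv i θ x • EuclideanSpace.single i (1 : ℝ)‖
      ≤ ∑ i, ‖Torus.partialDeriv i θ x • EuclideanSpace.single i (1 : ℝ)‖ := norm_sum_le _ _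
    _ ≤ ∑ _i : d, C := Finset.sum_le_sum fun i _ => by
        have hs : ‖EuclideanSpace.single i (1 : ℝ)‖ = 1 := by simp
        rw [norm_smul, hs, mul_one]
        exact hC i
    _ = Fintype.card d * C := by rw [Finset.sum_const, Finset.card_univ, nsmul_eq_mul]

/-- `‖div R(x)‖ ≤ |d| [R]₁` for a smooth column-tensor field (`(div R) = ∑ⱼ ∂ⱼ R^{(j)}` and
`‖∂ⱼ R^{(j)}‖ ≤ ‖∂ⱼ R‖`). [folklore] -/
theorem norm_tensorDivergence_le {R : UnitAddTorus d → d → EuclideanSpace ℝ d} (hR : IsSmooth R)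
    {D : ℝ} (x : UnitAddTorus d) (hD : ∀ i, ‖Torus.partialDeriv i R x‖ ≤ D) :
    ‖Torus.tensorDivergence R x‖ ≤ Fintype.card d * D := by
  unfold Torus.tensorDivergence
  calc ‖∑ j, Torus.partialDeriv j (fun y => R y j) x‖ ≤ ∑ j, ‖Torus.partialDeriv j (fun y => R y j) x‖ :=
        norm_sum_le _ _
    _ ≤ ∑ _j : d, D := Finset.sum_le_sum fun j _ => by
        have h : Torus.partialDeriv j (fun y => R y j) x = Torus.partialDeriv j R x j :=
          partialDeriv_clm_comp hR (ContinuousLinearMap.proj (R := ℝ) (φ := fun _ : d => EuclideanSpace ℝ d) j) j x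
        rw [h]
        exact (norm_le_pi_norm _ j).trans (hD j)
    _ = Fintype.card d * D := by rw [Finset.sum_const, Finset.card_univ, nsmul_eq_mul]

/-- **The time derivative of the velocity of a dissipative Euler–Reynolds flow from the
momentum equation** (DLK §2.2: "`‖∂ₜv_q‖₀ ≤ ‖v_q‖₀‖Dv_q‖₀ + ‖Dp_q‖₀ + ‖DR_q‖₀`"): from
`∂ₜv = div R - (v·∇)v - ∇p`, pointwise `‖∂ₜv‖ ≤ |d| (‖v‖[v]₁ + [p]₁ + [R]₁)`.
[cite: DelellisKwon2022, §2.2 (time regularity)] -/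
theorem norm_timeDerivWithin_velocity_le {S : Set ℝ} {v : ℝ → UnitAddTorus d → EuclideanSpace ℝ d}
    {p : ℝ → UnitAddTorus d → ℝ} {R : ℝ → UnitAddTorus d → d → EuclideanSpace ℝ d}
    {κ : ℝ → UnitAddTorus d → ℝ} {φ : ℝ → UnitAddTorus d → EuclideanSpace ℝ d} {E : ℝ → ℝ}
    (h : Torus.IsDissipativeEulerReynoldsOn S v p R κ φ E) {t : ℝ} (ht : t ∈ S) {A B C D : ℝ}
    (hv0 : ∀ x, ‖v t x‖ ≤ A) (hv1 : ∀ i x, ‖Torus.partialDeriv i (v t) x‖ ≤ B)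
    (hp1 : ∀ i x, ‖Torus.partialDeriv i (p t) x‖ ≤ C)
    (hR1 : ∀ i x, ‖Torus.partialDeriv i (R t) x‖ ≤ D) (x : UnitAddTorus d) :
    ‖Torus.timeDerivWithin S v t x‖ ≤ Fintype.card d * (A * B + C + D) := by
  have hmom := h.momentum t ht x
  have heq : Torus.timeDerivWithin S v t x =
      Torus.tensorDivergence (R t) x - Torus.convect (v t) (v t) x - Torus.gradient (p t) x := by
    rw [← hmom]; abel
  have hvs : IsContDiff 1 (v t) := (h.smooth_velocity.isSmooth_slice ht).isContDiff (by simp)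
  have hps : IsContDiff 1 (p t) := (h.smooth_pressure.isSmooth_slice ht).isContDiff (by simp)
  have hRs : IsSmooth (R t) := h.smooth_stress.isSmooth_slice ht
  rw [heq]
  calc ‖Torus.tensorDivergence (R t) x - Torus.convect (v t) (v t) x - Torus.gradient (p t) x‖
      ≤ ‖Torus.tensorDivergence (R t) x‖ + ‖Torus.convect (v t) (v t) x‖ + ‖Torus.gradient (p t) x‖ := by
        exact (norm_sub_le _ _).trans (add_le_add (norm_sub_le _ _) le_rfl)
    _ ≤ Fintype.card d * D + Fintype.card d * (A * B) + Fintype.card d * C :=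
        add_le_add (add_le_add (norm_tensorDivergence_le hRs x (fun i => hR1 i x))
          (norm_convect_le hvs x (hv0 x) (fun i => hv1 i x))) (norm_gradient_le hps x (fun i => hp1 i x))
    _ = Fintype.card d * (A * B + C + D) := by ring

end TimeDerivative

/-! ## Consequences of the estimates along an iteration sequence -/

namespace IsIterationSequence

variable {M α a b T : ℝ} {E : ℝ → ℝ} {v : ℕ → ℝ → 𝕋³ → ℝ³} {p : ℕ → ℝ → 𝕋³ → ℝ}
  {R : ℕ → ℝ → 𝕋³ → Fin 3 → ℝ³} {κ : ℕ → ℝ → 𝕋³ → ℝ} {φ : ℕ → ℝ → 𝕋³ → ℝ³}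

/-- The pressure is constant along the iteration: `p_q = p_0` on `[0,T] × 𝕋³`. [cite: DelellisKwon2022, §4.2] -/
theorem pressure_eq_zero_stage (h : IsIterationSequence M α a b T E v p R κ φ) :
    ∀ q, ∀ t ∈ Icc 0 T, ∀ x, p q t x = p 0 t x
  | 0 => fun _ _ _ => rfl
  | q + 1 => fun t ht x => by rw [h.pressure_succ q t ht x, pressure_eq_zero_stage h q t ht x]

/-- `‖∂ₜ v_q‖₀ ≤ 3(M+2) λ_q δ_q^{1/2}` on `[0,T]` along an iteration sequence
(`‖v_q‖₀ ≤ 1`, `[v_q]₁ ≤ Mλ_qδ_q^{1/2}`, `[p_q]₁ ≤ λ_qδ_q ≤ λ_qδ_q^{1/2}`,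
`[R_q]₁ ≤ λ_q^{1-3γ}δ_{q+1} ≤ λ_qδ_q^{1/2}`). [cite: DelellisKwon2022, §2.2 (time regularity)] -/
theorem norm_timeDerivWithin_le (h : IsIterationSequence M α a b T E v p R κ φ)
    (ha : 1 ≤ a) (hb : 1 ≤ b) (hα : 0 ≤ α) (q : ℕ) {t : ℝ} (ht : t ∈ Icc 0 T) (x : 𝕋³) :
    ‖Torus.timeDerivWithin (Icc 0 T) (v q) t x‖ ≤
      3 * (M + 2) * (freq a b q * Real.sqrt (amp α a b q)) := by
  set L := freq a b q * Real.sqrt (amp α a b q) with hL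
  have hfreq1 : 1 ≤ freq a b q := one_le_freq ha q
  have hfreq0 : 0 ≤ freq a b q := by linarith
  have hsq0 : 0 ≤ Real.sqrt (amp α a b q) := Real.sqrt_nonneg _
  have hL0 : 0 ≤ L := mul_nonneg hfreq0 hsq0
  -- `[p_q]₁ ≤ λ_q δ_q ≤ L`
  have hp : ∀ i y, ‖Torus.partialDeriv i (p q t) y‖ ≤ L := fun i y =>
    (h.pressure_deriv q i t ht y).trans (mul_le_mul_of_nonneg_left (amp_le_sqrt_amp ha hα q) hfreq0)
  -- `[R_q]₁ ≤ λ_q^{1-3γ} δ_{q+1} ≤ λ_q δ_q ≤ L`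
  have hR : ∀ i y, ‖Torus.partialDeriv i (R q t) y‖ ≤ L := fun i y => by
    refine (h.stress_deriv q i t ht y).trans ?_
    have h1 : freq a b q ^ (1 - 3 * (b - 1) ^ 2) ≤ freq a b q := by
      conv_rhs => rw [← Real.rpow_one (freq a b q)]
      exact Real.rpow_le_rpow_of_exponent_le hfreq1 (by nlinarith [sq_nonneg (b - 1)])
    have h2 : amp α a b (q + 1) ≤ Real.sqrt (amp α a b q) :=
      (amp_succ_le ha hb hα q).trans (amp_le_sqrt_amp ha hα q)
    exact mul_le_mul h1 h2 (amp_pos ha (q + 1)).le hfreq0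
  have hv0 : ∀ y, ‖v q t y‖ ≤ 1 := fun y =>
    (h.velocity_sup q t ht y).trans (by linarith [Real.sqrt_nonneg (amp α a b q)])
  have hmain := norm_timeDerivWithin_velocity_le (h.flow q) ht hv0
    (fun i y => h.velocity_deriv q i t ht y) hp hR x
  simp only [Fintype.card_fin, Nat.cast_ofNat, one_mul] at hmain
  calc ‖Torus.timeDerivWithin (Icc 0 T) (v q) t x‖ ≤ 3 * (M * freq a b q * Real.sqrt (amp α a b q) + L + L) := hmain
    _ = 3 * (M + 2) * L := by rw [hL]; ring

/-- `‖∂ₜ (v_{q+1} - v_q)‖₀ ≤ 6(M+2) λ_{q+1} δ_{q+1}^{1/2}` on `[0,T]` (`α ≤ 1`, so that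
`λ_qδ_q^{1/2} ≤ λ_{q+1}δ_{q+1}^{1/2}`). [cite: DelellisKwon2022, §2.2 (time regularity)] -/
theorem norm_timeDerivWithin_increment_le (h : IsIterationSequence M α a b T E v p R κ φ)
    (hM : 0 ≤ M) (ha : 1 ≤ a) (hb : 1 ≤ b) (hα : 0 ≤ α) (hα1 : α ≤ 1) (hT : 0 < T) (q : ℕ)
    {t : ℝ} (ht : t ∈ Icc 0 T) (x : 𝕋³) :
    ‖Torus.timeDerivWithin (Icc 0 T) (fun s y => v (q + 1) s y - v q s y) t x‖ ≤
      6 * (M + 2) * (freq a b (q + 1) * Real.sqrt (amp α a b (q + 1))) := by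
  have hsub : Torus.timeDerivWithin (Icc 0 T) (fun s y => v (q + 1) s y - v q s y) t x =
      Torus.timeDerivWithin (Icc 0 T) (v (q + 1)) t x - Torus.timeDerivWithin (Icc 0 T) (v q) t x := by
    exact (((h.flow (q + 1)).smooth_velocity.hasDerivWithinAt_slice ht x).sub
      ((h.flow q).smooth_velocity.hasDerivWithinAt_slice ht x)).derivWithin (uniqueDiffOn_Icc hT t ht)
  rw [hsub]
  have h1 := h.norm_timeDerivWithin_le ha hb hα (q + 1) ht x
  have h2 := (h.norm_timeDerivWithin_le ha hb hα q ht x).trans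
    (mul_le_mul_of_nonneg_left (freq_mul_sqrt_amp_le_succ ha hb hα1 q) (by positivity))
  calc ‖Torus.timeDerivWithin (Icc 0 T) (v (q + 1)) t x - Torus.timeDerivWithin (Icc 0 T) (v q) t x‖
      ≤ ‖Torus.timeDerivWithin (Icc 0 T) (v (q + 1)) t x‖ + ‖Torus.timeDerivWithin (Icc 0 T) (v q) t x‖ :=
        norm_sub_le _ _
    _ ≤ _ := by linarith

/-- The errors vanish uniformly: `‖R_q‖₀ → 0` (from (2.7): `‖R_q‖₀ ≤ λ_q^{-3γ}δ_{q+1} ≤ δ_{q+1}`).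
[cite: DelellisKwon2022, §2.2] -/
theorem stress_unifSmall (h : IsIterationSequence M α a b T E v p R κ φ) (ha : 1 < a)
    (hb : 1 < b) (hα : 0 < α) :
    ∀ ε > (0 : ℝ), ∃ N : ℕ, ∀ q ≥ N, ∀ t ∈ Icc 0 T, ∀ x, ‖R q t x‖ ≤ ε := by
  refine unifSmall_of_le_of_tendsto (fun q t ht x => (h.stress_sup q t ht x).trans ?_)
    (tendsto_amp_succ ha hb hα)
  have h1 : freq a b q ^ (-(3 * (b - 1) ^ 2)) ≤ 1 :=
    freq_rpow_neg_le_one ha.le (by nlinarith [sq_nonneg (b - 1)]) q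
  exact (mul_le_of_le_one_left (amp_pos ha.le (q + 1)).le h1)

/-- `‖κ_q‖₀ → 0`: `κ_q = ½ tr R_q` and `|tr R_q| ≤ 3‖R_q‖`. [cite: DelellisKwon2022, §2.2] -/
theorem kappa_unifSmall (h : IsIterationSequence M α a b T E v p R κ φ) (ha : 1 < a)
    (hb : 1 < b) (hα : 0 < α) :
    ∀ ε > (0 : ℝ), ∃ N : ℕ, ∀ q ≥ N, ∀ t ∈ Icc 0 T, ∀ x, ‖κ q t x‖ ≤ ε := by
  intro ε hε
  obtain ⟨N, hN⟩ := h.stress_unifSmall ha hb hα (ε / 2) (half_pos hε)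
  refine ⟨N, fun q hq t ht x => ?_⟩
  have hk := (h.flow q).kappa_eq t ht x
  have hRi : ∀ i, |R q t x i i| ≤ ε / 2 := fun i =>
    ((abs_apply_le_norm' (R q t x i) i).trans (norm_le_pi_norm (R q t x) i)).trans (hN q hq t ht x)
  rw [hk, Real.norm_eq_abs, abs_mul, Fin.sum_univ_three]
  have h2 : |(2 : ℝ)⁻¹| = 2⁻¹ := abs_of_pos (by norm_num)
  rw [h2]
  calc 2⁻¹ * |R q t x 0 0 + R q t x 1 1 + R q t x 2 2|
      ≤ 2⁻¹ * (|R q t x 0 0| + |R q t x 1 1| + |R q t x 2 2|) := by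
        gcongr
        exact (abs_add_le _ _).trans (add_le_add (abs_add_le _ _) le_rfl)
    _ ≤ 2⁻¹ * (ε / 2 + ε / 2 + ε / 2) := by gcongr <;> exact hRi _
    _ ≤ ε := by linarith
  where
  /-- `|wᵢ| ≤ ‖w‖` for a Euclidean vector. -/
  abs_apply_le_norm' (w : ℝ³) (i : Fin 3) : |w i| ≤ ‖w‖ := by
    simpa using PiLp.norm_apply_le w i

/-- `‖φ_q‖₀ → 0` (from (2.8): `‖φ_q‖₀ ≤ λ_q^{-3γ}δ_{q+1}^{3/2} ≤ δ_{q+1}`). [cite: DelellisKwon2022, §2.2] -/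
theorem current_unifSmall (h : IsIterationSequence M α a b T E v p R κ φ) (ha : 1 < a)
    (hb : 1 < b) (hα : 0 < α) :
    ∀ ε > (0 : ℝ), ∃ N : ℕ, ∀ q ≥ N, ∀ t ∈ Icc 0 T, ∀ x, ‖φ q t x‖ ≤ ε := by
  refine unifSmall_of_le_of_tendsto (fun q t ht x => (h.current_sup q t ht x).trans ?_)
    (tendsto_amp_succ ha hb hα)
  have h1 : freq a b q ^ (-(3 * (b - 1) ^ 2)) ≤ 1 :=
    freq_rpow_neg_le_one ha.le (by nlinarith [sq_nonneg (b - 1)]) q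
  have h0' := amp_pos (β := α) (b := b) ha.le (q + 1)
  have h0 := h0'.le
  have h2 : amp α a b (q + 1) ^ (3 / 2 : ℝ) ≤ amp α a b (q + 1) := by
    conv_rhs => rw [← Real.rpow_one (amp α a b (q + 1))]
    exact Real.rpow_le_rpow_of_exponent_ge h0' (amp_le_one ha.le hα.le (q + 1)) (by norm_num)
  calc freq a b q ^ (-(3 * (b - 1) ^ 2)) * amp α a b (q + 1) ^ (3 / 2 : ℝ)
      ≤ 1 * amp α a b (q + 1) := mul_le_mul h1 h2 (Real.rpow_nonneg h0 _) zero_le_one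
    _ = amp α a b (q + 1) := one_mul _

/-- **Uniform convergence of the velocities to a `C^β` limit** (DLK §2.2: "`{v_q}` is Cauchy
in `C⁰([0,T]; C^α(𝕋³))` ... the time regularity of `v` can be concluded with an analogous
interpolation argument ... Hence `v ∈ C^α([0,T] × 𝕋³)`", here for every `β < α`): along an
iteration sequence with `0 ≤ β < α ≤ 1`, `a > 1`, `b > 1`, `M ≥ 0`, `T > 0`, there is
`u ∈ C^β([0,T] × 𝕋³)` with `v_q → u` uniformly on `[0,T] × 𝕋³`. The increments have sup
`σ_q = Mδ_{q+1}^{1/2} = Mλ_{q+1}^{-α}` (summable) and space–time Lipschitz constants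
`≲ λ_{q+1}δ_{q+1}^{1/2} = λ_{q+1}^{1-α}`, so `σ_q^{1-β} Lip_q^β ≲ λ_{q+1}^{β-α}` is summable
(`Torus.exists_unifTo_holderOnSpaceTime`). [cite: DelellisKwon2022, §2.2 (convergence and regularity)] -/
theorem exists_unifTo_holder (h : IsIterationSequence M α a b T E v p R κ φ) {β : ℝ≥0}
    (hβα : (β : ℝ) < α) (hα1 : α ≤ 1) (ha : 1 < a) (hb : 1 < b) (hM : 0 ≤ M) (hT : 0 < T) :
    ∃ u : ℝ → 𝕋³ → ℝ³,
      (∀ ε > (0 : ℝ), ∃ N : ℕ, ∀ q ≥ N, ∀ t ∈ Icc 0 T, ∀ x, ‖v q t x - u t x‖ ≤ ε) ∧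
        HolderOnSpaceTime β T u := by
  have hβ0 : 0 ≤ (β : ℝ) := β.coe_nonneg
  have hα : 0 < α := lt_of_le_of_lt hβ0 hβα
  have hβ1 : β ≤ 1 := by
    have : (β : ℝ) ≤ 1 := by linarith
    exact_mod_cast this
  -- the stage-0 velocity is Lipschitz on the compact `[0,T] × 𝕋³`, hence `β`-Hölder there
  have hsm : ∀ q, FunctionSpaces.Torus.IsSmoothSpaceTimeOn (Icc 0 T) (v q) := fun q =>
    (h.flow q).smooth_velocity
  obtain ⟨C₁, hC₁0, hC₁⟩ := exists_forall_norm_iterPartialDeriv_le (uniqueDiffOn_Icc hT)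
    isCompact_Icc subset_rfl 1 (hsm 0)
  obtain ⟨C₀, hC₀⟩ := (hsm 0).exists_norm_le_of_isCompact isCompact_Icc subset_rfl
  obtain ⟨Ct, hCt⟩ := ((hsm 0).timeDerivWithin (uniqueDiffOn_Icc hT)).exists_norm_le_of_isCompact
    isCompact_Icc subset_rfl
  have hLip0 : LipschitzOnWith (NNReal.sqrt (Fintype.card (Fin 3)) * ∑ _i : Fin 3, Real.toNNReal C₁ +
      Real.toNNReal Ct) (uncurry (v 0)) (Icc 0 T ×ˢ univ) :=
    lipschitzOnWith_uncurry_of_bounds (hsm 0)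
      (fun i t ht x => by
        rw [Real.coe_toNNReal C₁ hC₁0]
        simpa using hC₁ t ht [i] (by simp) x)
      (fun t ht x => (hCt t ht x).trans (Real.le_coe_toNNReal Ct))
  set K₀ : ℝ := (2 * max C₀ 0) ^ (1 - (β : ℝ)) *
    ((NNReal.sqrt (Fintype.card (Fin 3)) * ∑ _i : Fin 3, Real.toNNReal C₁ + Real.toNNReal Ct : ℝ≥0) : ℝ) ^ (β : ℝ)
    with hK₀
  have hK₀0 : 0 ≤ K₀ := by positivity
  have h0 : ∀ z ∈ Icc 0 T ×ˢ (univ : Set 𝕋³), ∀ z' ∈ Icc 0 T ×ˢ (univ : Set 𝕋³),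
      ‖uncurry (v 0) z - uncurry (v 0) z'‖ ≤ K₀ * dist z z' ^ (β : ℝ) := fun z hz z' hz' =>
    norm_sub_le_interpolate_on (s := Icc 0 T ×ˢ (univ : Set 𝕋³)) (w := uncurry (v 0))
      (fun z hz => by
        obtain ⟨t, x⟩ := z
        exact (hC₀ t (mem_prod.1 hz).1 x).trans (le_max_left _ _))
      hLip0 hβ0 (by exact_mod_cast hβ1) hz hz'
  -- increments: sup `σ_q`, spatial Lipschitz `M_q`, time Lipschitz `B_q`
  set σ : ℕ → ℝ := fun q => M * Real.sqrt (amp α a b (q + 1)) with hσ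
  set Lq : ℕ → ℝ := fun q => freq a b (q + 1) * Real.sqrt (amp α a b (q + 1)) with hLq
  have hLq0 : ∀ q, 0 ≤ Lq q := fun q => mul_nonneg (freq_pos ha.le (q + 1)).le (Real.sqrt_nonneg _)
  have hσ0 : ∀ q, 0 ≤ σ q := fun q => mul_nonneg hM (Real.sqrt_nonneg _)
  have hσeq : ∀ q, σ q = M * freq a b (q + 1) ^ (-α) := fun q => by
    show M * Real.sqrt (amp α a b (q + 1)) = _
    rw [sqrt_amp ha.le]
  have hσs : Summable σ := by
    rw [show σ = fun q => M * freq a b (q + 1) ^ (-α) from funext hσeq]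
    exact (summable_freq_succ_rpow_neg ha hb hα).mul_left M
  set Mq : ℕ → Fin 3 → ℝ≥0 := fun q _ => Real.toNNReal (M * Lq q) with hMq
  set Bq : ℕ → ℝ≥0 := fun q => Real.toNNReal (6 * (M + 2) * Lq q) with hBq
  have hMqb : ∀ q i, ∀ t ∈ Icc 0 T, ∀ x,
      ‖Torus.partialDeriv i (fun y => v (q + 1) t y - v q t y) x‖ ≤ Mq q i := fun q i t ht x => by
    show _ ≤ ((Real.toNNReal (M * Lq q) : ℝ≥0) : ℝ)
    rw [Real.coe_toNNReal _ (mul_nonneg hM (hLq0 q))]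
    have := h.increment_deriv q i t ht x
    simpa [hLq, mul_assoc] using this
  have hBqb : ∀ q, ∀ t ∈ Icc 0 T, ∀ x,
      ‖Torus.timeDerivWithin (Icc 0 T) (fun s y => v (q + 1) s y - v q s y) t x‖ ≤ Bq q :=
    fun q t ht x => (h.norm_timeDerivWithin_increment_le hM ha.le hb.le hα.le hα1 hT q ht x).trans
      (Real.le_coe_toNNReal _)
  -- summability of `(2σ_q)^{1-β} (√3 ∑ M_q + B_q)^β ≤ const · λ_{q+1}^{β-α}`
  have hsum : Summable fun q => (2 * σ q) ^ (1 - (β : ℝ)) *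
      ((NNReal.sqrt (Fintype.card (Fin 3)) * ∑ i, Mq q i + Bq q : ℝ≥0) : ℝ) ^ (β : ℝ) := by
    -- the bracket equals `c · Lq q` with `c = 3√3 M + 6(M+2)`
    set c : ℝ := Real.sqrt 3 * (3 * M) + 6 * (M + 2) with hc
    have hc0 : 0 ≤ c := by positivity
    have hbr : ∀ q, ((NNReal.sqrt (Fintype.card (Fin 3)) * ∑ i, Mq q i + Bq q : ℝ≥0) : ℝ) = c * Lq q := by
      intro q
      rw [hMq, hBq]
      push_cast
      rw [Finset.sum_const, Finset.card_univ, Fintype.card_fin, Real.coe_toNNReal _ (mul_nonneg hM (hLq0 q)),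
        Real.coe_toNNReal _ (mul_nonneg (by positivity) (hLq0 q)), hc]
      simp only [nsmul_eq_mul, Nat.cast_ofNat]
      ring
    have hLqeq : ∀ q, Lq q = freq a b (q + 1) ^ (1 - α) := fun q => freq_mul_sqrt_amp ha.le (q + 1)
    have hterm : ∀ q, (2 * σ q) ^ (1 - (β : ℝ)) * (c * Lq q) ^ (β : ℝ) =
        (2 * M) ^ (1 - (β : ℝ)) * c ^ (β : ℝ) * freq a b (q + 1) ^ (-(α - β)) := by
      intro q
      have hf := freq_pos (b := b) ha.le (q + 1)
      rw [hσeq, hLqeq, ← mul_assoc, Real.mul_rpow (by positivity) (Real.rpow_nonneg hf.le _),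
        Real.mul_rpow hc0 (Real.rpow_nonneg hf.le _), ← Real.rpow_mul hf.le, ← Real.rpow_mul hf.le]
      have hexp : freq a b (q + 1) ^ (-α * (1 - (β : ℝ))) * freq a b (q + 1) ^ ((1 - α) * (β : ℝ)) =
          freq a b (q + 1) ^ (-(α - β)) := by
        rw [← Real.rpow_add hf]; congr 1; ring
      calc (2 * M) ^ (1 - (β : ℝ)) * freq a b (q + 1) ^ (-α * (1 - (β : ℝ))) *
            (c ^ (β : ℝ) * freq a b (q + 1) ^ ((1 - α) * (β : ℝ)))
          = (2 * M) ^ (1 - (β : ℝ)) * c ^ (β : ℝ) *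
              (freq a b (q + 1) ^ (-α * (1 - (β : ℝ))) * freq a b (q + 1) ^ ((1 - α) * (β : ℝ))) := by ring
        _ = _ := by rw [hexp]
    simp_rw [hbr, hterm]
    exact (summable_freq_succ_rpow_neg ha hb (by linarith : 0 < α - β)).mul_left _
  exact exists_unifTo_holderOnSpaceTime hβ1 hsm hK₀0 h0 hσ0 (fun q t ht x => h.increment_sup q t ht x)
    hσs hMqb hBqb hsum

end IsIterationSequence

/-! ## Thm. 1.1 from an iteration sequence (§2.3 assembled) -/

section Assembly

variable {M α a b T : ℝ} {E : ℝ → ℝ} {v : ℕ → ℝ → 𝕋³ → ℝ³} {p : ℕ → ℝ → 𝕋³ → ℝ}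
  {R : ℕ → ℝ → 𝕋³ → Fin 3 → ℝ³} {κ : ℕ → ℝ → 𝕋³ → ℝ} {φ : ℕ → ℝ → 𝕋³ → ℝ³}

/-- **De Lellis–Kwon 2022, Thm. 1.1, from an iteration sequence** (§2.2–2.3 of the printed
proof, assembled): let `0 ≤ β < α ≤ 1`, `a > 1`, `b > 1`, `M ≥ 0`, `T > 0`, and let
`(v_q, p_q, R_q, κ_q, φ_q)` be an iteration sequence on `[0,T]` (`DLK.IsIterationSequence`) for an
energy loss `E` with `E' ≤ 0` on `[0,T]` and `E(T) < E(0)` (DLK take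
`E(t) = -δ₁(1 - e^{-δ₀^{1/2}t})`). Then the uniform limit `u` of the `v_q` exists, is of class
`C^β([0,T] × 𝕋³)`, `(u, p₀)` is a globally dissipative Euler flow on `[0,T] × 𝕋³`, and
`½∫|u(T)|² < ½∫|u(0)|²` — i.e. `(u, p₀)` witnesses the conclusion of
`Torus.DeLellisKwon2022_thm11` for `β` and `T`. Proof: `DLK.IsIterationSequence.exists_unifTo_holder`
(convergence and regularity), the errors vanish uniformly (`stress_unifSmall`,
`kappa_unifSmall`, `current_unifSmall`), the pressures are constant in `q`, and
`Torus.deLellisKwon2022_thm11_witness_of_iteration` (limit flow, energy identity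
`½∫|u(T)|² - ½∫|u(0)|² = (E(T) - E(0))/2 < 0`). [cite: DelellisKwon2022, Thm. 1.1 (proof, §2.2–2.3)] -/
theorem deLellisKwon2022_thm11_witness_of_iterationSequence {β : ℝ≥0}
    (h : IsIterationSequence M α a b T E v p R κ φ) (hβα : (β : ℝ) < α) (hα1 : α ≤ 1)
    (ha : 1 < a) (hb : 1 < b) (hM : 0 ≤ M) (hT : 0 < T)
    (hE' : ∀ t ∈ Icc 0 T, deriv E t ≤ 0) (hET : E T < E 0) :
    ∃ (u : ℝ → 𝕋³ → ℝ³) (P : ℝ → 𝕋³ → ℝ),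
      Torus.IsGloballyDissipativeEulerOn T u P ∧ FunctionSpaces.HolderOnSpaceTime β T u ∧
        FunctionSpaces.Torus.kineticEnergy (u T) < FunctionSpaces.Torus.kineticEnergy (u 0) := by
  have hα : 0 < α := lt_of_le_of_lt β.coe_nonneg hβα
  obtain ⟨u, hv, hHolder⟩ := h.exists_unifTo_holder hβα hα1 ha hb hM hT
  have hp : ∀ ε > (0 : ℝ), ∃ N : ℕ, ∀ q ≥ N, ∀ t ∈ Icc 0 T, ∀ x, ‖p q t x - p 0 t x‖ ≤ ε :=
    fun ε hε => ⟨0, fun q _ t ht x => by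
      rw [h.pressure_eq_zero_stage q t ht x, sub_self, norm_zero]; exact hε.le⟩
  exact Torus.deLellisKwon2022_thm11_witness_of_iteration hT h.flow hE' hET hv hp
    (h.stress_unifSmall ha hb hα) (h.kappa_unifSmall ha hb hα) (h.current_unifSmall ha hb hα) hHolder

/-- **`Torus.DeLellisKwon2022_thm11` from the existence of iteration sequences** (the shape of
the printed proof of Thm. 1.1: "arguing as in the previous section we can use inductively
Proposition 2.3 to produce a sequence `(v_q, p_q)` which is converging uniformly ..."): if for
every `0 ≤ β < 1/7` and `T > 0` there are parameters `β < α ≤ 1`, `a > 1`, `b > 1`, `M ≥ 0`, an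
energy loss `E` with `E' ≤ 0` on `[0,T]` and `E(T) < E(0)`, and an iteration sequence on `[0,T]`
for them (the output of DLK Prop. 2.3 started from the tuple of §2.3 — the convex-integration
construction of §§3–11, not formalised in the tree), then the named fact
`Torus.DeLellisKwon2022_thm11` holds. [cite: DelellisKwon2022, Thm. 1.1 (proof, §2.3)] -/
theorem deLellisKwon2022_thm11_of_iterationSequences
    (hseq : ∀ β : ℝ, 0 ≤ β → β < 1 / 7 → ∀ T : ℝ, 0 < T →
      ∃ (M α a b : ℝ) (E : ℝ → ℝ) (v : ℕ → ℝ → 𝕋³ → ℝ³) (p : ℕ → ℝ → 𝕋³ → ℝ)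
        (R : ℕ → ℝ → 𝕋³ → Fin 3 → ℝ³) (κ : ℕ → ℝ → 𝕋³ → ℝ) (φ : ℕ → ℝ → 𝕋³ → ℝ³),
        β < α ∧ α ≤ 1 ∧ 1 < a ∧ 1 < b ∧ 0 ≤ M ∧ IsIterationSequence M α a b T E v p R κ φ ∧
          (∀ t ∈ Icc 0 T, deriv E t ≤ 0) ∧ E T < E 0) :
    Torus.DeLellisKwon2022_thm11 := by
  intro β hβ T hT
  have hβ' : (β : ℝ) < 1 / 7 := by
    have : ((β : ℝ≥0) : ℝ) < ((1 / 7 : ℝ≥0) : ℝ) := NNReal.coe_lt_coe.2 hβ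
    simpa using this
  obtain ⟨M, α, a, b, E, v, p, R, κ, φ, hβα, hα1, ha, hb, hM, h, hE', hET⟩ :=
    hseq β β.coe_nonneg hβ' T hT
  exact deLellisKwon2022_thm11_witness_of_iterationSequence h hβα hα1 ha hb hM hT hE' hET

end Assembly

end DLK

end Literature.Analysis.FluidPDE
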